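import Mathlib
import Summits.PneNP.PneNP.Theorems.Nc03AvoidResidualCoreCandStarReductionCherryStar
import Summits.PneNP.PneNP.Theorems.Nc03AvoidResidualCoreReductionCand

/-!
# Route Nc03AvoidResidualCore, item `CandStarReduction` (★) — registered stub `stub_tangledSplit`

Stub file for `stmt-PneNP-19963` (cell pnp-ideate; birth skeleton
Cruxes/CandStarReduction/Lines/birth.lean, tribunal-w g6): **`stub_tangledSplit :
CandMatchAvoidLinearFP → TangledSurplusFP → CandAvoidLinearFP`** — the branch of the cell memo
ROUND-3-ADDENDUM-B Thm B.1 "Consequently", as ONE `CodeFP` program on input codes: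

* parse and strip (`Nc03CandStar.prOfRI ∘ Nc03Reduction.toRaw`, landed), COUNT the tangled outputs
  in-program (`tangCount`, `= #(tangled I)` by `tangCount_eq`) and branch on `n + 1 ≤ tangCount`
  (`surplusB`; no oracle, no promise);
* surplus branch: the ★-solver of `TangledSurplusFP` (a hypothesis, consumed AS GIVEN) applied to the
  ORIGINAL input code;
* otherwise: the untangled outputs (`untang`, raw form `prU` = `rawOf` of the sub-instance
  `restrict I ιu`, `rawOf_restrict_eq_prU`) form a PURE MATCHING-CLASS instance on the same `n` inputs
  (`…CandCherry.restrict_isPure`, `…CandCherry.untangled_isMatchingClass` — cited, landed) with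
  `m - #tangled ≥ m - n ≥ C₁·n` outputs once `m ≥ (C₁ + 1)·n`; its input code is rebuilt by the
  landed `Nc03Reduction.unparse` (`unparse_rawOf`), the X₁-solver of `CandMatchAvoidLinearFP` (a
  hypothesis, consumed AS GIVEN) answers, and the answer is re-embedded along `ιu` (`embedU`,
  `embedU_ιu`) — outside the range by `Nc03Reduction.not_mem_range_of_restrict`.
Stretch constant `C₁ + 1`; ONE `f`, ONE `C`, both outside `∀ n m I`; polynomial time only through
`CodeFP` bricks + `CookBridges.isPolyTime_iff`.

Restricted-model (NC⁰₃) range-avoidance rung F-N1b of the PneNP frontier ladder (an algorithmic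
reduction between two restricted AVOID problems); nothing here bears on P vs NP.
-/

set_option linter.dupNamespace false -- `Summit.PneNP.PneNP.…`: summit = sub-problem name (D-0017 single-conjunct layout)

namespace Summit.PneNP.PneNP.Theorems.Nc03CandStarRF

open Finset Literature.Computability.Complexity CodeFP
open Summit.PneNP.PneNP.Theorems.Nc03Reduction
  (PRaw ETrip RI Inst eIn toRaw riE prE tripE etE enumT rawOf tripOf mem_enumT_iff mem_enumT rawOf_eq
    codeFP_toRaw codeFP_enumT codeFP_N codeFP_M restrict not_mem_range_of_restrict unparse unparse_rawOf codeFP_unparse)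
open Summit.PneNP.PneNP.Theorems.Nc03AvoidResidualCoreCandCherry
  (tangled mem_tangled untangled_isMatchingClass restrict_isPure card_compl_tangled)
open Summit.PneNP.PneNP.Theorems.Nc03AvoidResidualCoreCandMatchRung (IsMatchingClass)
open Summit.PneNP.PneNP.Theorems.Nc03CandStar (prOfRI prOfRI_toRaw codeFP_prOfRI)

/-! ## The program -/

/-- The number of tangled outputs. -/
def tangCount (pr : PRaw) : ℕ := ((enumT pr).filter (tangB pr)).length

/-- The branch test: at least `n + 1` tangled outputs. -/
def surplusB (pr : PRaw) : Bool := decide (pr.1 + 1 ≤ tangCount pr)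

/-- The untangled enumerated outputs (increasing indices). -/
def untang (pr : PRaw) : List ETrip := (enumT pr).filter fun e => !tangB pr e

/-- The raw form of the untangled sub-instance: same variables, the untangled triples. -/
def prU (pr : PRaw) : PRaw := (pr.1, (untang pr).length, (untang pr).map Prod.snd)

/-- Looking up the bit attached to output index `j` in a keyed list (default `false`). -/
def lookupE (A : List (ETrip × Bool)) (j : ℕ) : Bool :=
  (A.find? fun t => decide (t.1.1 = j)).elim false fun t => t.2

/-- Re-embedding an answer for the untangled sub-instance: untangled output at sub-position `p` gets
bit `p` of the answer, tangled outputs get `false`. -/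
def embedU (pr : PRaw) (w : List Bool) : List Bool :=
  (List.range pr.2.1).map fun j =>
    lookupE ((untang pr).zip ((List.range (untang pr).length).map fun p => w.getD p false)) j

/-- The non-surplus branch: rebuild the sub-instance's input code, ask the matching-class solver,
re-embed. -/
def splitOut (f₁ : List Bool → List Bool) (pr : PRaw) : List Bool := embedU pr (f₁ (unparse (prU pr)))

/-! ## Counting tangled outputs -/

variable {N M : ℕ} (J : LocalMap 3 N M)

/-- Lengths of filtered enumerations are cardinalities. -/
theorem length_filter_enumT (q : ETrip → Bool) :
    ((enumT (rawOf J)).filter q).length = #(univ.filter fun p : Fin M => q (eOf J p) = true) := by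
  rw [enumT_rawOf, List.ofFn_eq_map, List.filter_map, List.length_map,
    ← List.toFinset_card_of_nodup ((List.nodup_finRange M).filter _), List.toFinset_filter,
    List.toFinset_finRange]
  rfl

/-- **The program's tangledness test is the tree's `tangled`.** -/
theorem tangB_iff_mem_tangled (p : Fin M) : tangB (rawOf J) (eOf J p) = true ↔ p ∈ tangled J := by
  constructor
  · intro h
    unfold tangB at h
    rw [List.any_eq_true] at h
    obtain ⟨e', he', h⟩ := h
    obtain ⟨p', rfl⟩ := (mem_enumT_iff J).1 he'
    simp only [Bool.and_eq_true, Bool.not_eq_true', decide_eq_false_iff_not, decide_eq_true_eq,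
      Bool.or_eq_true] at h
    obtain ⟨⟨hne, hhead⟩, hd⟩ := h
    have hne' : p' ≠ p := fun e => hne (congrArg Fin.val e)
    have hhead' : J.vars p' 0 = J.vars p 0 := Fin.ext hhead
    rcases hd with hd | hd
    · rcases (isData_iff' J p' (J.vars p 1)).1 hd with h | h
      · exact mem_tangled.2 ⟨p', hne', hhead', 1, 1, by decide, by decide, h.symm⟩
      · exact mem_tangled.2 ⟨p', hne', hhead', 1, 2, by decide, by decide, h.symm⟩
    · rcases (isData_iff' J p' (J.vars p 2)).1 hd with h | h
      · exact mem_tangled.2 ⟨p', hne', hhead', 2, 1, by decide, by decide, h.symm⟩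
      · exact mem_tangled.2 ⟨p', hne', hhead', 2, 2, by decide, by decide, h.symm⟩
  · exact tangB_of_mem_tangled J

/-- **The program counts the tangled outputs.** -/
theorem tangCount_eq : tangCount (rawOf J) = #(tangled J) := by
  unfold tangCount
  rw [length_filter_enumT]
  congr 1
  ext p
  simp only [Finset.mem_filter, Finset.mem_univ, true_and, tangB_iff_mem_tangled]

/-- The number of untangled outputs. -/
theorem length_untang : (untang (rawOf J)).length = M - #(tangled J) := by
  unfold untang
  rw [length_filter_enumT, ← card_compl_tangled]
  congr 1
  ext p
  simp only [Finset.mem_filter, Finset.mem_univ, true_and, Finset.mem_compl, Bool.not_eq_true',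
    ← tangB_iff_mem_tangled, Bool.not_eq_true]

/-! ## The untangled sub-instance -/

/-- Members of `untang` are untangled genuine outputs. -/
theorem mem_untang {e : ETrip} (h : e ∈ untang (rawOf J)) :
    ∃ p : Fin M, e = eOf J p ∧ p ∉ tangled J := by
  unfold untang at h
  rw [List.mem_filter] at h
  obtain ⟨p, rfl⟩ := (mem_enumT_iff J).1 h.1
  refine ⟨p, rfl, fun hp => ?_⟩
  have := (tangB_iff_mem_tangled J p).2 hp
  rw [this] at h
  exact Bool.noConfusion h.2

/-- The indices of `untang` increase. -/
theorem untang_pairwise : (untang (rawOf J)).Pairwise fun e e' => e.1 < e'.1 := by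
  unfold untang
  refine List.Pairwise.filter _ ?_
  rw [enumT_rawOf, List.pairwise_ofFn]
  intro i j hij
  exact hij

/-- The number of outputs of the sub-instance. -/
abbrev MU : ℕ := (untang (rawOf J)).length

/-- The `p`-th untangled enumerated output. -/
def uAt (p : Fin (MU J)) : ETrip := (untang (rawOf J))[p.val]'p.isLt

/-- The output index map of the sub-instance. -/
def ιu (p : Fin (MU J)) : Fin M := ⟨(uAt J p).1, by
  obtain ⟨p', hp', -⟩ := mem_untang J (List.getElem_mem p.isLt : uAt J p ∈ untang (rawOf J))
  unfold uAt; rw [hp']; exact p'.isLt⟩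

/-- The `p`-th untangled output is the enumerated output of `ιu p`, and is untangled. -/
theorem uAt_eq (p : Fin (MU J)) : uAt J p = eOf J (ιu J p) ∧ ιu J p ∉ tangled J := by
  obtain ⟨p', hp', hnt⟩ := mem_untang J (List.getElem_mem p.isLt : uAt J p ∈ untang (rawOf J))
  have hι : ιu J p = p' := Fin.ext (by show (uAt J p).1 = p'.val; unfold uAt; rw [hp'])
  rw [hι]
  exact ⟨by unfold uAt; exact hp', hnt⟩

/-- The output index map increases. -/
theorem ιu_lt {p p' : Fin (MU J)} (h : p < p') : (ιu J p).val < (ιu J p').val :=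
  List.pairwise_iff_getElem.1 (untang_pairwise J) p.val p'.val p.isLt p'.isLt h

/-- The output index map is injective. -/
theorem ιu_injective : Function.Injective (ιu J) := by
  intro p p' h
  rcases lt_trichotomy p p' with hlt | heq | hgt
  · exact absurd (congrArg Fin.val h) (Nat.ne_of_lt (ιu_lt J hlt))
  · exact heq
  · exact absurd (congrArg Fin.val h).symm (Nat.ne_of_lt (ιu_lt J hgt))

/-- **The program's raw sub-instance is the raw form of the restricted instance.** -/
theorem rawOf_restrict_eq_prU : rawOf (restrict J (ιu J)) = prU (rawOf J) := by
  unfold prU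
  rw [rawOf_eq]
  refine Prod.ext rfl (Prod.ext rfl ?_)
  apply List.ext_getElem
  · simp
  · intro i h1 h2
    rw [List.length_ofFn] at h1
    rw [List.getElem_ofFn, List.getElem_map]
    have h := (uAt_eq J ⟨i, h1⟩).1
    unfold uAt at h
    simp only at h
    rw [h]
    rfl

/-- The restricted instance is untangled, hence matching-class. -/
theorem restrict_isMatchingClass : IsMatchingClass (restrict J (ιu J)) :=
  untangled_isMatchingClass J (ιu J) (ιu_injective J) fun p => (uAt_eq J p).2

/-! ## Reading the re-embedding -/

/-- In a keyed list with increasing keys zipped with values, the lookup of the `p`-th key returns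
the `p`-th value. -/
theorem lookupE_zip {B : List ETrip} (hB : B.Pairwise fun e e' => e.1 < e'.1) {w : List Bool}
    {p : ℕ} (hp : p < B.length) (hpw : p < w.length) : lookupE (B.zip w) (B[p].1) = w[p] := by
  unfold lookupE
  have hz : p < (B.zip w).length := by rw [List.length_zip]; exact lt_min hp hpw
  have hfind : (B.zip w).find? (fun t => decide (t.1.1 = B[p].1)) = some (B[p], w[p]) := by
    rw [List.find?_eq_some_iff_getElem]
    refine ⟨by simp, p, hz, by rw [List.getElem_zip], fun j hj => ?_⟩
    rw [List.getElem_zip, Bool.not_eq_true', decide_eq_false_iff_not]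
    exact Nat.ne_of_lt (List.pairwise_iff_getElem.1 hB j p (by omega) hp hj)
  rw [hfind]
  rfl

/-- **The re-embedded answer read at an untangled output** is the answer's bit at its sub-position. -/
theorem embedU_ιu (w : List Bool) (p : Fin (MU J)) :
    (embedU (rawOf J) w).getD (ιu J p).val false = w.getD p.val false := by
  unfold embedU
  rw [List.getD_eq_getElem?_getD, List.getElem?_map,
    List.getElem?_range (by exact (ιu J p).isLt : (ιu J p).val < (rawOf J).2.1)]
  simp only [Option.map_some, Option.getD_some]
  have hlen : ((List.range (untang (rawOf J)).length).map fun q => w.getD q false).length = MU J := by simp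
  have h := lookupE_zip (untang_pairwise J) (w := (List.range (untang (rawOf J)).length).map fun q => w.getD q false)
    (p := p.val) p.isLt (by rw [hlen]; exact p.isLt)
  rw [show (untang (rawOf J))[p.val].1 = (ιu J p).val from rfl] at h
  rw [h, List.getElem_map, List.getElem_range]

/-- The re-embedded list has length `M`. -/
theorem length_embedU (pr : PRaw) (w : List Bool) : (embedU pr w).length = pr.2.1 := by simp [embedU]

/-- **The non-surplus branch is correct**, relative to the matching-class solver. -/
theorem splitOut_correct (hP : J.IsPure candPred) {f₁ : List Bool → List Bool} {C₁ : ℕ}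
    (hf₁ : ∀ N' M' (I' : LocalMap 3 N' M'), I'.IsPure candPred ∧ IsMatchingClass I' → 0 < N' → C₁ * N' ≤ M' →
      readOut M' (f₁ I'.encode) ∉ I'.range)
    (hN : 0 < N) (hM : (C₁ + 1) * N ≤ M) (hT : #(tangled J) ≤ N) :
    (fun j : Fin M => (splitOut f₁ (rawOf J)).getD j.val false) ∉ J.range := by
  have hMU : MU J = M - #(tangled J) := length_untang J
  have hTM : #(tangled J) ≤ M := (Finset.card_le_univ _).trans (by simp)
  have hstretch : C₁ * N ≤ MU J := by
    rw [hMU, Nat.add_mul, one_mul] at *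
    omega
  have hpure : (restrict J (ιu J)).IsPure candPred := restrict_isPure hP (ιu J)
  have hout := hf₁ N (MU J) (restrict J (ιu J)) ⟨hpure, restrict_isMatchingClass J⟩ hN hstretch
  have hcode : unparse (prU (rawOf J)) = (restrict J (ιu J)).encode := by
    rw [← rawOf_restrict_eq_prU, unparse_rawOf _ hpure]
  apply not_mem_range_of_restrict J (ιu J)
  have e : (fun i : Fin (MU J) => (splitOut f₁ (rawOf J)).getD (ιu J i).val false) =
      readOut (MU J) (f₁ (restrict J (ιu J)).encode) := by
    funext i
    unfold splitOut readOut
    rw [embedU_ιu, hcode]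
  rw [e]
  exact hout

/-! ## Polynomial time -/

/-- `tangCount` is polynomial time. -/
theorem codeFP_tangCount : CodeFP prE natE tangCount :=
  ((natLength etE).comp ((filter codeFP_tangB).comp ((CodeFP.id _).pair codeFP_enumT))).congr fun _ => rfl

/-- `surplusB` is polynomial time. -/
theorem codeFP_surplusB : CodeFP prE bitE surplusB :=
  (natLe.comp ((natAdd.comp ((natOfUn.comp codeFP_N).pair (const _ 1))).pair codeFP_tangCount)).congr fun _ => rfl

/-- `untang` is polynomial time. -/
theorem codeFP_untang : CodeFP prE (rawE etE) untang :=
  ((filter codeFP_tangB.not).comp ((CodeFP.id _).pair codeFP_enumT)).congr fun _ => rfl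

/-- `prU` is polynomial time. -/
theorem codeFP_prU : CodeFP prE prE prU :=
  (codeFP_N.pair (((ulength etE).comp codeFP_untang).pair ((map₀ (snd natE tripE)).comp codeFP_untang))).congr
    fun _ => rfl

/-- `lookupE` is polynomial time. -/
theorem codeFP_lookupE : CodeFP (pairE (rawE (pairE etE bitE)) natE) bitE (fun q => lookupE q.1 q.2) := by
  have hp : CodeFP (pairE natE (pairE etE bitE)) bitE (fun y => decide (y.2.1.1 = y.1)) :=
    natEq.comp ((snd _ _).fst'.fst'.pair (fst _ _))
  have hf : CodeFP (pairE (rawE (pairE etE bitE)) natE) (optE (pairE etE bitE))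
      (fun q => q.1.find? fun t => decide (t.1.1 = q.2)) :=
    ((rawFind? hp).comp ((snd _ _).pair (fst _ _))).congr fun _ => rfl
  have hk := optCases (σ := List (ETrip × Bool) × ℕ) (eσ := pairE (rawE (pairE etE bitE)) natE)
    (eα := pairE etE bitE) (eδ := bitE) (k := fun _ o => o.elim false fun t => t.2)
    (gnone := fun _ => false) (gsome := fun y => y.2.2) (const _ false) (snd _ _).snd' (fun _ => rfl) (fun _ _ => rfl)
  exact (hk.comp ((CodeFP.id _).pair hf)).congr fun _ => rfl

/-- `embedU` is polynomial time (context: the answer string). -/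
theorem codeFP_embedU : CodeFP (pairE prE strE) (rawE bitE) (fun q => embedU q.1 q.2) := by
  let cE : PRaw × List Bool → List Bool := pairE prE strE
  have hU : CodeFP cE (rawE etE) (fun q => untang q.1) := codeFP_untang.comp (fst _ _)
  have hwl : CodeFP cE (rawE bitE) (fun q => (List.range (untang q.1).length).map fun p => q.2.getD p false) :=
    ((map (strGetDNat.comp ((fst _ _).pair (snd _ _)))).comp ((snd _ _).pair (urange.comp ((ulength etE).comp hU)))).congr
      fun _ => rfl
  have hA : CodeFP cE (rawE (pairE etE bitE))
      (fun q => (untang q.1).zip ((List.range (untang q.1).length).map fun p => q.2.getD p false)) :=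
    (rawZip etE bitE).comp (hU.pair hwl)
  have hitem : CodeFP (pairE cE natE) bitE (fun y =>
      lookupE ((untang y.1.1).zip ((List.range (untang y.1.1).length).map fun p => y.1.2.getD p false)) y.2) :=
    codeFP_lookupE.comp ((hA.comp (fst _ _)).pair (snd _ _))
  exact ((map hitem).comp ((CodeFP.id _).pair (urange.comp (codeFP_M.comp (fst _ _))))).congr fun _ => rfl

/-- The non-surplus branch is polynomial time, relative to a polynomial-time matching-class solver. -/
theorem codeFP_splitOut {f₁ : List Bool → List Bool} (hf₁ : IsPolyTime f₁) : CodeFP prE (rawE bitE) (splitOut f₁) := by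
  have hF : CodeFP strE strE f₁ := of_fn f₁ ((CookBridges.isPolyTime_iff f₁).1 hf₁) fun _ => rfl
  have hw : CodeFP prE strE (fun pr => f₁ (unparse (prU pr))) := hF.comp (codeFP_unparse.comp codeFP_prU)
  exact (codeFP_embedU.comp ((CodeFP.id _).pair hw)).congr fun _ => rfl

/-- **The split solver on input codes is ONE polynomial-time program**: branch on the tangled count,
the ★-solver on the original code, or the re-embedded matching-class answer. -/
theorem codeFP_splitSolver {f₁ g : List Bool → List Bool} (hf₁ : IsPolyTime f₁) (hg : IsPolyTime g) :
    CodeFP eIn strE (fun x => if surplusB (prOfRI (toRaw x)) then g (eIn x) else splitOut f₁ (prOfRI (toRaw x))) := by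
  have hpr : CodeFP eIn prE (fun x => prOfRI (toRaw x)) := codeFP_prOfRI.comp codeFP_toRaw
  have hG : CodeFP eIn strE (fun x => g (eIn x)) := of_fn g ((CookBridges.isPolyTime_iff g).1 hg) fun _ => rfl
  have hH : CodeFP eIn strE (fun x => splitOut f₁ (prOfRI (toRaw x))) :=
    (bitsToStr.comp ((codeFP_splitOut hf₁).comp hpr)).congr fun _ => rfl
  exact CodeFP.ite (codeFP_surplusB.comp hpr) hG hH

end Summit.PneNP.PneNP.Theorems.Nc03CandStarRF

namespace Summit.PneNP.PneNP.Theorems.Nc03CandStar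

open Finset Literature.Computability.Complexity CodeFP
open Summit.PneNP.PneNP.Theses.Nc03AvoidResidualCore (CandMatchAvoidLinearFP CandAvoidLinearFP)
open Summit.PneNP.PneNP.Theorems.Nc03Reduction (eIn toRaw rawOf)
open Summit.PneNP.PneNP.Theorems.Nc03AvoidResidualCoreCandCherry (tangled)

/-- **Registered stub `stub_tangledSplit` of the birth skeleton of `CandStarReduction`** (Thm B.1,
"Consequently"): a polynomial-time avoider for pure matching-class `CAND` instances at stretch `C₁`
and a polynomial-time avoider for pure `CAND` instances with a tangled surplus give ONE
polynomial-time avoider for all pure `CAND` instances at stretch `C₁ + 1`. -/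
theorem stub_tangledSplit : CandMatchAvoidLinearFP → TangledSurplusFP → CandAvoidLinearFP := by
  intro h₁ h₂
  unfold CandMatchAvoidLinearFP LocalAvoidLinearFP at h₁
  unfold TangledSurplusFP at h₂
  unfold CandAvoidLinearFP LocalAvoidLinearFP
  obtain ⟨C₁, f₁, hf₁, hspec₁⟩ := h₁
  obtain ⟨g, hg, hgspec⟩ := h₂
  obtain ⟨F, hF, hFspec⟩ := Nc03CandStarRF.codeFP_splitSolver (f₁ := f₁) (g := g) hf₁ hg
  refine ⟨C₁ + 1, F, (CookBridges.isPolyTime_iff F).2 hF, fun n m I hP hn hm => ?_⟩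
  have hFI : F I.encode = if Nc03CandStarRF.surplusB (rawOf I) then g I.encode else Nc03CandStarRF.splitOut f₁ (rawOf I) := by
    rw [show I.encode = eIn ⟨n, m, I⟩ from rfl, hFspec]
    show (if Nc03CandStarRF.surplusB (prOfRI (toRaw ⟨n, m, I⟩)) then g (eIn ⟨n, m, I⟩) else Nc03CandStarRF.splitOut f₁ (prOfRI (toRaw ⟨n, m, I⟩))) = _
    rw [prOfRI_toRaw]
  by_cases hs : Nc03CandStarRF.surplusB (rawOf I) = true
  · rw [hFI, if_pos hs]
    have hT : n + 1 ≤ #(tangled I) := by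
      unfold Nc03CandStarRF.surplusB at hs
      rw [decide_eq_true_eq, Nc03CandStarRF.tangCount_eq] at hs
      exact hs
    exact hgspec n m I hP hn hT
  · rw [hFI, if_neg hs]
    have hT : #(tangled I) ≤ n := by
      unfold Nc03CandStarRF.surplusB at hs
      rw [decide_eq_true_eq, Nc03CandStarRF.tangCount_eq] at hs
      exact Nat.lt_succ_iff.1 (Nat.lt_of_not_le hs)
    have e : readOut m (Nc03CandStarRF.splitOut f₁ (rawOf I)) = fun j : Fin m => (Nc03CandStarRF.splitOut f₁ (rawOf I)).getD j.val false := rfl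
    rw [e]
    exact Nc03CandStarRF.splitOut_correct I hP (fun N' M' I' hQ hN' hM' => hspec₁ N' M' I' hQ hN' hM') hn hm hT

end Summit.PneNP.PneNP.Theorems.Nc03CandStar
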